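import Summits.BirchSwinnertonDyer.BirchSwinnertonDyer.Theorems.BiquadraticEisensteinDescentHeegnerTwistCouplingInSupplySylvesterTwistSharpKernel
import Literature.NumberTheory.EllipticCurves.ThreeIsogenyKernelX
import Literature.NumberTheory.EllipticCurves.IsogenyDualProofs
import Literature.NumberTheory.EllipticCurves.ShaIsogenyProofs
import HarnessLib

set_option linter.dupNamespace false -- `Summit.BirchSwinnertonDyer.BirchSwinnertonDyer.Theorems.…` (summit = sub, D-0017)
set_option autoImplicit false

/-!
# Crux `HeegnerTwistCouplingInSupply` (stmt-BirchSwinnertonDyer-21381) — programme «TWISTED 3-ISOGENY DESCENT», file P7c-A2: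
# `Ш(E/ℚ)[3] = 0` for the Sylvester twist `E : y² = x³ − 2p²` (`p ≡ 8 (mod 9)`, `p = a² + 2b²`) under the certificates (h1) ∧ (h2)

Route `BiquadraticEisensteinDescent` (cell `pub/bsd-wall`, width seat `bsd-wall-cm-bed-w4` g33; `--supports` 21381, helper). The two
halves P7a (`Ш(E'/ℚ) ∩ ker φ̂_* = 0` under (h2) `9 ∤ a`, Kummer field `ℚ(√−2)`) and P7b (`Ш(E/ℚ) ∩ ker φ_* = 0` under (h1), Kummer
field `ℚ(√6)`), in the kernel form of file P7c-A1, are assembled over `ℚ` along the `3`-isogeny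
`φ : E = mordellCurve(−2p²) → E' = mordellCurve(54p²)` with kernel polynomial `x` (tree `IsKernelXThreePair.toIsogeny`, a genuine
`Isogeny` over `ℚ`) and its abstract dual `ψ` (`ψ ∘ φ = [3]`, tree `Isogeny.exists_dual_of_isElliptic`):

* §3 `isKernelXThreePair_mordell` (the pair `E → E'`), `galAut_sigmaTilde_eq_self_of_sq_eq` / `…_eq_neg_of_sq_eq` (the lift `σ̃ ∈ Γ_ℚ`
  of the conjugation of `F = ℚ(√6)` composed with `√−3 ↦ −√−3` FIXES `±p√−2` and NEGATES `±3p√6`), ★ `dual_apply_eq_zero_of_x_eq_zero`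
  (`ψ(0, ±3p√6) = O`: `φψ(T̂) = 3T̂ = O` puts `ψT̂` in `ker φ = {O, ±T}`, and `σ̃T̂ = −T̂`, `σ̃T = T`, `T ≠ −T` exclude `±T`),
  ★ `dual_ker_subset` (`ker ψ ⊆ {O} ∪ {x = 0}` by the `3`-torsion lemma and Vélu's `X = (x³ + 4k)/x²`);
* §4 ★★★ `forall_mem_sha_three_nsmul_eq_zero` — **`Ш(E/ℚ)[3] = 0`**: `c ∈ Ш(E)`, `3c = 0` ⟹ `φ_* c ∈ Ш(E') ∩ ker ψ_* = 0` (φ̂-half,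
  (h2)) ⟹ `c ∈ Ш(E) ∩ ker φ_* = 0` (φ-half, (h1)).

HONEST FRAMING: `Ш[3] = 0` for ONE CM family under the two decidable certificates (h1) (a unit of `𝓞_{ℚ(√6)}` is a non-cube mod `p`) and
(h2) (`9 ∤ a`); the rank (`E(ℚ)` finite), `hDescU`, the crux (residual C⁺) and BSD are untouched. THEOREMS ONLY (no `def`, no named
fact, no sorry). Supports stmt-BirchSwinnertonDyer-21381.
[cite: CohenPazuki2009, Proposition 2.2] [cite: SilvermanAEC2009, Thm. X.4.2 (a), Thm. III.6.1 (a)] [cite: CremonaAlgorithms1997, §3.8]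
-/

noncomputable section

open scoped Classical

namespace Summit.BirchSwinnertonDyer.BirchSwinnertonDyer.Theorems.SylvesterTwistDescent

open Literature.NumberTheory.EllipticCurves Literature.NumberTheory.EllipticCurves.MordellDescent
open Literature.NumberTheory.EllipticCurves.TwistedKummer Literature.NumberTheory.QuadraticFields
open Literature.NumberTheory.GaloisRepresentations NumberField
open WeierstrassCurve

/-! ## §3 The isogeny `φ : E → E'` with kernel polynomial `x`, the lift `σ̃`, and the kernel of the dual -/

section KernelX

/-- **The Mordell pair `y² = x³ + k → Y² = X³ − 27k` is a kernel-`x` three-pair** (`a = b = 0`, `c = k`).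
[cite: CremonaAlgorithms1997, §3.8] -/
theorem isKernelXThreePair_mordell {k k' : ℚ} (hk : k ≠ 0) (hk' : k' = -27 * k) :
    IsKernelXThreePair (0 : ℚ) 0 k (mordellCurve k) (mordellCurve k') where
  a₁_eq := rfl
  a₂_eq := rfl
  a₃_eq := rfl
  a₄_eq := rfl
  a₆_eq := rfl
  a₁'_eq := rfl
  a₂'_eq := rfl
  a₃'_eq := rfl
  a₄'_eq := by simp
  a₆'_eq := by rw [mordellCurve_a₆, hk']; ring
  rel := by ring
  Δ_ne := by rw [mordellCurve_Δ]; exact neg_ne_zero.mpr (mul_ne_zero (by norm_num) (pow_ne_zero 2 hk))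

variable {F : Type} [Field F] [NumberField F] (cbar : AlgebraicClosure F ≃+* AlgebraicClosure F)

/-- `σ̃ = ι⁻¹ c̄ ι ∈ Γ_ℚ` FIXES `y ∈ ℚ̄` when `ι y = ±z` with `c̄ z = z`. [cite: CohenPazuki2009, Definition 1.3 (G₃)] -/
theorem galAut_sigmaTilde_eq_self_of_sq_eq {y : AlgebraicClosure ℚ} {z : AlgebraicClosure F}
    (hyz : iotaE (K := ℚ) F y ^ 2 = z ^ 2) (hz : cbar z = z) : galAut (sigmaTilde cbar) y = y := by
  have key : iotaE (K := ℚ) F (galAut (sigmaTilde cbar) y) = iotaE (K := ℚ) F y := by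
    rw [iotaE_sigmaTilde]
    rcases sq_eq_sq_iff_eq_or_eq_neg.mp hyz with h | h
    · rw [h, hz]
    · rw [h, map_neg, hz]
  exact (iotaE (K := ℚ) F).injective key

/-- `σ̃ = ι⁻¹ c̄ ι ∈ Γ_ℚ` NEGATES `y ∈ ℚ̄` when `ι y = ±z` with `c̄ z = −z`. [cite: CohenPazuki2009, Definition 1.3 (G₃)] -/
theorem galAut_sigmaTilde_eq_neg_of_sq_eq {y : AlgebraicClosure ℚ} {z : AlgebraicClosure F}
    (hyz : iotaE (K := ℚ) F y ^ 2 = z ^ 2) (hz : cbar z = -z) : galAut (sigmaTilde cbar) y = -y := by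
  have key : iotaE (K := ℚ) F (galAut (sigmaTilde cbar) y) = iotaE (K := ℚ) F (-y) := by
    rw [iotaE_sigmaTilde, map_neg]
    rcases sq_eq_sq_iff_eq_or_eq_neg.mp hyz with h | h
    · rw [h, hz]
    · rw [h, map_neg, hz, neg_neg]
  exact (iotaE (K := ℚ) F).injective key

variable (hF2 : Module.finrank ℚ F = 2) {ω : F} (hω : ω ^ 2 = 6) (c : F ≃ₐ[ℚ] F) (hc : c ≠ 1) {p : ℕ} (hp : p.Prime)
  (hX : IsKernelXThreePair (0 : ℚ) 0 (-2 * (p : ℚ) ^ 2) (mordellCurve (-2 * (p : ℚ) ^ 2)) (mordellCurve (54 * (p : ℚ) ^ 2)))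
  (ψ : Isogeny (mordellCurve (54 * (p : ℚ) ^ 2)) (mordellCurve (-2 * (p : ℚ) ^ 2)))
  (hψ : ∀ P, ψ (hX.toIsogeny P) = ((3 : ℕ) : ℤ) • P)

include hψ in
/-- `φ (ψ Q) = 3Q` (as `φ` is onto and `ψ φ = [3]`). [cite: SilvermanAEC2009, Thm. III.6.1 (a)] -/
theorem toIsogeny_dual_apply (Q : geomPoints (mordellCurve (54 * (p : ℚ) ^ 2))) : hX.toIsogeny (ψ Q) = ((3 : ℕ) : ℤ) • Q := by
  obtain ⟨P, rfl⟩ := hX.toIsogeny_surjective Q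
  rw [hψ, map_zsmul]

include hF2 hω hc hp hψ in
/-- ★ **The dual kills the points with `x = 0`**: `ψ(0, ±3p√6) = O`. `φψ(T̂) = 3T̂ = O` puts `ψT̂` in `ker φ = {O, ±T}`,
`T = (0, ±p√−2)`; the lift `σ̃ ∈ Γ_ℚ` of (conjugation of `ℚ(√6)`) ∘ (`√−3 ↦ −√−3`) negates `T̂` and fixes `T`, and `ψ` is equivariant,
so `ψT̂ = ±T` would give `T = −T`. [cite: SilvermanAEC2009, Thm. III.6.1 (a), Thm. X.4.2 (a)] -/
theorem dual_apply_eq_zero_of_x_eq_zero (y : AlgebraicClosure ℚ)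
    (h : ((mordellCurve (54 * (p : ℚ) ^ 2)).baseChange (AlgebraicClosure ℚ)).toAffine.Nonsingular 0 y) :
    ψ (Affine.Point.some 0 y h) = 0 := by
  obtain ⟨P', hP'⟩ : ∃ P' : geomPoints (mordellCurve (54 * (p : ℚ) ^ 2)), P' = Affine.Point.some 0 y h := ⟨_, rfl⟩
  rw [← hP']
  have hcω : c ω = -ω := algEquiv_omega hF2 hω hc
  have hp0 : (p : ℚ) ≠ 0 := Nat.cast_ne_zero.mpr hp.ne_zero
  have hk0' : (54 * (p : ℚ) ^ 2) ≠ 0 := mul_ne_zero (by norm_num) (pow_ne_zero 2 hp0)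
  have hd24 := discr_eq_twentyFour hF2 hω
  have hL : ∀ q : F, q ^ 2 ≠ -3 := sq_ne_neg_three_of_discr_pos hF2 (by rw [hd24]; norm_num)
  obtain ⟨cbar, hcbar, hcbθ⟩ := exists_lift_neg_theta' hL (c : F ≃+* F)
  -- `3 T̂ = 0` for `T̂ = (0, y)`
  have hs : y ^ 2 = algebraMap ℚ (AlgebraicClosure ℚ) (54 * (p : ℚ) ^ 2) := sq_eq_of_nonsingular_zero h
  have hV' := isVeluThreePair_of_sq_eq hk0' hs
  have hTT : P' + P' = -P' := by rw [hP']; exact hV'.T_add_T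
  have hneg : -P' = (show geomPoints (mordellCurve (54 * (p : ℚ) ^ 2)) from Affine.Point.some 0 (-y) hV'.nonsingular_negT) := by
    rw [hP']; exact hV'.neg_T
  have h3T : ((3 : ℕ) : ℤ) • P' = 0 := by
    rw [natCast_zsmul, succ_nsmul, two_nsmul, hTT, neg_add_cancel]
  -- `ψ T̂ ∈ ker φ = {O, ±T}`
  have hker : ψ P' = 0 ∨ ψ P' = hX.geom.T ∨ ψ P' = -hX.geom.T := by
    have h0 : hX.toIsogeny (ψ P') = 0 := by rw [toIsogeny_dual_apply hX ψ hψ, h3T]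
    rw [IsKernelXThreePair.toIsogeny_apply] at h0
    exact (hX.geom.pointFun_eq_zero_iff _).mp h0
  -- `σ̃` negates `y` (`ι y = ±3pω`) and fixes `gs` (`ι gs = ±(pω/3)√−3`)
  have hs' : y ^ 2 = 54 * (p : AlgebraicClosure ℚ) ^ 2 := by rw [hs, map_mul, map_pow, map_natCast, map_ofNat]
  have hyz : iotaE (K := ℚ) F y ^ 2 = (algebraMap F (AlgebraicClosure F) (3 * p * ω)) ^ 2 := by
    have e2 : algebraMap F (AlgebraicClosure F) (3 * p * ω) ^ 2 = 54 * (p : AlgebraicClosure F) ^ 2 := by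
      rw [← map_pow, show ((3 : F) * p * ω) ^ 2 = 54 * (p : F) ^ 2 by linear_combination (9 * (p : F) ^ 2) * hω, map_mul,
        map_pow, map_natCast, map_ofNat]
    rw [e2, ← map_pow, hs', map_mul, map_pow, map_natCast, map_ofNat]
  have hz : cbar (algebraMap F (AlgebraicClosure F) (3 * p * ω)) = -algebraMap F (AlgebraicClosure F) (3 * p * ω) := by
    rw [hcbar, ← map_neg]; congr 1
    change c (3 * p * ω) = -(3 * p * ω)
    rw [map_mul, map_mul, map_natCast, map_ofNat, hcω]; ring
  have hσy : galAut (sigmaTilde cbar) y = -y := galAut_sigmaTilde_eq_neg_of_sq_eq cbar hyz hz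
  have hgs' : hX.gs ^ 2 = -2 * (p : AlgebraicClosure ℚ) ^ 2 := by rw [hX.gs_sq, map_mul, map_pow, map_natCast, map_neg, map_ofNat]
  have hgs : iotaE (K := ℚ) F hX.gs ^ 2 = sCoord (p * ω / 3 : F) ^ 2 := by
    have e2 : sCoord (p * ω / 3 : F) ^ 2 = -2 * (p : AlgebraicClosure F) ^ 2 := by
      rw [sCoord_sq, show (-3 : F) * (p * ω / 3) ^ 2 = -2 * (p : F) ^ 2 by linear_combination (-(p : F) ^ 2 / 3) * hω, map_mul,
        map_pow, map_natCast, map_neg, map_ofNat]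
    rw [e2, ← map_pow, hgs', map_mul, map_pow, map_natCast, map_neg, map_ofNat]
  have hzs : cbar (sCoord (p * ω / 3 : F)) = sCoord (p * ω / 3 : F) := by
    have hcc : (c : F ≃+* F) (p * ω / 3) = -(p * ω / 3) := by
      change c (p * ω / 3) = -(p * ω / 3)
      rw [map_div₀, map_mul, map_natCast, map_ofNat, hcω]; ring
    rw [sCoord, map_mul, hcbar, hcbθ, hcc, map_neg]; ring
  have hσgs : galAut (sigmaTilde cbar) hX.gs = hX.gs := galAut_sigmaTilde_eq_self_of_sq_eq cbar hgs hzs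
  -- the Galois action on `T̂` and `T`
  have hσT' : sigmaTilde cbar • P' = -P' := by
    rw [hneg, hP']
    change sigmaTilde cbar • (show geomPoints (mordellCurve (54 * (p : ℚ) ^ 2)) from Affine.Point.some 0 y h) = _
    rw [smul_geomPoints_some (sigmaTilde cbar) _ (nonsingular_galAut (sigmaTilde cbar) h)]
    exact point_some_ext (map_zero _) hσy
  have hσT : sigmaTilde cbar • hX.geomT = hX.geomT := by
    change sigmaTilde cbar • (show geomPoints (mordellCurve (-2 * (p : ℚ) ^ 2)) from
      Affine.Point.some 0 hX.gs hX.geom.nonsingular_T) = Affine.Point.some 0 hX.gs hX.geom.nonsingular_T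
    rw [smul_geomPoints_some (sigmaTilde cbar) _ (nonsingular_galAut (sigmaTilde cbar) hX.geom.nonsingular_T)]
    exact point_some_ext (map_zero _) hσgs
  have hTne : hX.geomT ≠ -hX.geomT := hX.geomT_ne_neg
  have heq : ψ (sigmaTilde cbar • P') = sigmaTilde cbar • ψ P' := ψ.map_smul _ _
  rw [hσT', map_neg] at heq
  rcases hker with h0 | h0 | h0
  · exact h0
  · exfalso
    have h0' : ψ P' = hX.geomT := h0
    rw [h0', hσT] at heq; exact hTne heq.symm
  · exfalso
    have h0' : ψ P' = -hX.geomT := h0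
    rw [h0', smul_neg, hσT, neg_neg] at heq; exact hTne heq

include hψ in
/-- ★ **`ker ψ ⊆ {O} ∪ {x = 0}`**: `ψP' = O`, `P' = φQ` ⟹ `3Q = O` ⟹ `Q = O`, or `x(Q) = 0` (`φQ = O`), or `x(Q)³ = −4k` and then
`X(φQ) = (x³ + 4k)/x² = 0`. [cite: SilvermanAEC2009, Thm. III.6.1 (a)] [cite: Knapp1993, Ch. V §6, proof of Thm. 5.3] -/
theorem dual_ker_subset (P' : geomPoints (mordellCurve (54 * (p : ℚ) ^ 2))) (hP' : ψ P' = 0) :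
    P' = 0 ∨ ∃ (y : AlgebraicClosure ℚ) (h : ((mordellCurve (54 * (p : ℚ) ^ 2)).baseChange (AlgebraicClosure ℚ)).toAffine.Nonsingular 0 y),
      P' = Affine.Point.some 0 y h := by
  obtain ⟨Q, rfl⟩ := hX.toIsogeny_surjective P'
  have h3 : (3 : ℕ) • Q = 0 := by rw [← natCast_zsmul, ← hψ Q]; exact hP'
  rcases Q with _ | ⟨x, y, hQ⟩
  · exact Or.inl (map_zero _)
  · have hB : ((mordellCurve (-2 * (p : ℚ) ^ 2)).baseChange (AlgebraicClosure ℚ)).a₆ =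
        algebraMap ℚ (AlgebraicClosure ℚ) (-2 * (p : ℚ) ^ 2) := by rw [mordellCurve_baseChange]; rfl
    obtain ⟨-, hx⟩ := three_nsmul_some_eq_zero ((mordellCurve (-2 * (p : ℚ) ^ 2)).baseChange (AlgebraicClosure ℚ))
      (by rw [mordellCurve_baseChange]; rfl) (by rw [mordellCurve_baseChange]; rfl) (by rw [mordellCurve_baseChange]; rfl)
      (by rw [mordellCurve_baseChange]; rfl) hB hQ h3
    by_cases hx0 : x = 0
    · left; rw [IsKernelXThreePair.toIsogeny_apply, hX.geom.pointFun_some_of_eq_zero _ hx0]; rfl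
    · right
      have hx3 : x ^ 3 + 4 * algebraMap ℚ (AlgebraicClosure ℚ) (-2 * (p : ℚ) ^ 2) = 0 :=
        (mul_eq_zero.mp hx).resolve_left hx0
      have hXx : hX.geom.X x = 0 := by
        rw [hX.geom_X, div_eq_zero_iff]
        left
        simp only [map_zero, map_mul, map_neg, map_pow, map_natCast, map_ofNat] at hx3 ⊢
        linear_combination hx3
      rw [IsKernelXThreePair.toIsogeny_apply, hX.geom.pointFun_some _ hx0]
      exact ⟨hX.geom.Y x y, by rw [← hXx]; exact hX.geom.nonsingular_image hQ hx0, point_some_ext hXx rfl⟩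

end KernelX

/-! ## §4 `Ш(E/ℚ)[3] = 0` -/

section Assembly

variable {F : Type} [Field F] [NumberField F] (hF2 : Module.finrank ℚ F = 2) {ω : F} (hω : ω ^ 2 = 6) (cF : F ≃ₐ[ℚ] F)
  (hcF : cF ≠ 1) {K : Type} [Field K] [NumberField K] {θ : K} (hK : SqrtNegTwo.FieldData θ) (cK : K ≃ₐ[ℚ] K) (hcK : cK ≠ 1)
  {p : ℕ} (hp : p.Prime) (hp9 : p % 9 = 8) {a b : ℤ} (hab : a ^ 2 + 2 * b ^ 2 = p)

include hF2 hω hcF hK hcK hp hp9 hab in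
/-- ★★★ **`Ш(E/ℚ)[3] = 0` for the Sylvester twist `E : y² = x³ − 2p²`** (`p ≡ 8 (mod 9)` prime, `p = a² + 2b²`) under the two
certificates (h2) `9 ∤ a` and (h1) «some unit of `𝓞_{ℚ(√6)}` is not a cube modulo `(p)`» (stated on models `F ∋ ω`, `ω² = 6`,
and `K ∋ θ`, `θ² = −2`, with their non-trivial automorphisms). With `φ : E → E' = mordellCurve(54p²)` the `3`-isogeny with kernel
polynomial `x` and `ψ` its dual: `c ∈ Ш(E)`, `3c = 0` ⟹ `ψ_*(φ_* c) = 3c = 0` ⟹ `φ_* c ∈ Ш(E') ∩ ker ψ_* = 0` (P7a, (h2))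
⟹ `c ∈ Ш(E) ∩ ker φ_* = 0` (P7b, (h1)). [cite: CohenPazuki2009, Proposition 2.2] [cite: SilvermanAEC2009, Thm. X.4.2 (a), Thm. III.6.1 (a)] -/
theorem forall_mem_sha_three_nsmul_eq_zero (h9 : ¬ (9 : ℤ) ∣ a)
    (h1 : ∃ u₀ : (𝓞 F)ˣ, ∀ x : 𝓞 F, (u₀ : 𝓞 F) - x ^ 3 ∉ Ideal.span {(p : 𝓞 F)}) :
    ∀ c ∈ (mordellCurve (-2 * (p : ℚ) ^ 2)).sha, 3 • c = 0 → c = 0 := by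
  intro c₀ hc₀ h3
  have hp0 : (p : ℚ) ≠ 0 := Nat.cast_ne_zero.mpr hp.ne_zero
  have hk0 : (-2 * (p : ℚ) ^ 2) ≠ 0 := mul_ne_zero (by norm_num) (pow_ne_zero 2 hp0)
  have hk0' : (54 * (p : ℚ) ^ 2) ≠ 0 := mul_ne_zero (by norm_num) (pow_ne_zero 2 hp0)
  haveI := isElliptic_mordellCurve hk0
  haveI := isElliptic_mordellCurve hk0'
  have hX : IsKernelXThreePair (0 : ℚ) 0 (-2 * (p : ℚ) ^ 2) (mordellCurve (-2 * (p : ℚ) ^ 2)) (mordellCurve (54 * (p : ℚ) ^ 2)) :=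
    isKernelXThreePair_mordell hk0 (by ring)
  have hdeg : hX.toIsogeny.degree = 3 := hX.natCard_ker_toIsogeny
  obtain ⟨ψ, hψ⟩ := hX.toIsogeny.exists_dual_of_isElliptic
  rw [hdeg] at hψ
  -- `φ_* c₀ ∈ Ш(E')` is killed by `ψ_*`
  have hc₁ : galH1Map hX.toIsogeny.toAddMonoidHom hX.toIsogeny.equivariant c₀ ∈ (mordellCurve (54 * (p : ℚ) ^ 2)).sha :=
    galH1Map_mem_sha _ _ hX.toIsogeny.hasLocalPointsMaps_toAddMonoidHom hc₀
  have hψφ : ∀ P, ψ.toAddMonoidHom (hX.toIsogeny.toAddMonoidHom P) = ((3 : ℕ) : ℤ) • P := hψ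
  have hψc₁ : galH1Map ψ.toAddMonoidHom ψ.equivariant (galH1Map hX.toIsogeny.toAddMonoidHom hX.toIsogeny.equivariant c₀) = 0 := by
    rw [galH1Map_galH1Map_of_comp_eq_nsmul _ hX.toIsogeny.equivariant _ ψ.equivariant hψφ c₀, h3]
  -- `Ш(E') ∩ ker ψ_* = 0` (the `φ̂`-half, (h2))
  have hc₁0 : galH1Map hX.toIsogeny.toAddMonoidHom hX.toIsogeny.equivariant c₀ = 0 :=
    eq_zero_of_mem_sha_of_galH1Map_eq_zero_of_ker_x_zero_phiHat hK cK hcK hp hp9 hab h9 ψ.toAddMonoidHom ψ.equivariant ψ.surjective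
      (fun y h => dual_apply_eq_zero_of_x_eq_zero hF2 hω cF hcF hp hX ψ hψ y h) (fun P' hP' => dual_ker_subset hX ψ hψ P' hP')
      hc₁ hψc₁
  -- `Ш(E) ∩ ker φ_* = 0` (the `φ`-half, (h1))
  refine eq_zero_of_mem_sha_of_galH1Map_eq_zero_of_ker_x_zero_phi hF2 hω cF hcF hp hp9 hab h1 hX.toIsogeny.toAddMonoidHom
    hX.toIsogeny.equivariant hX.toIsogeny_surjective (fun y h => ?_) (fun P hP => ?_) hc₀ hc₁0
  · change hX.toIsogeny (Affine.Point.some 0 y h) = 0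
    rw [IsKernelXThreePair.toIsogeny_apply, hX.geom.pointFun_some_of_eq_zero _ rfl]; rfl
  · have hP' : hX.toIsogeny P = 0 := hP
    rw [IsKernelXThreePair.toIsogeny_apply] at hP'
    rcases (hX.geom.pointFun_eq_zero_iff P).mp hP' with h | h | h
    · exact Or.inl h
    · exact Or.inr ⟨hX.gs, hX.geom.nonsingular_T, h⟩
    · exact Or.inr ⟨-hX.gs, hX.geom.nonsingular_negT, by rw [h, hX.geom.neg_T]⟩

end Assembly

end Summit.BirchSwinnertonDyer.BirchSwinnertonDyer.Theorems.SylvesterTwistDescent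

end
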